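import Summits.QuantumFields.YangMills.Theorems.BalabanUVNodesN19JointLawPriceCompositionsLipschitz
import Summits.QuantumFields.YangMills.Theorems.BalabanUVNodesN19JointLawPriceAbsolutePolynomials

/-!
# YM-DAG node N19 (= NE7 proper) — JACKSON FORM OF THE |MONOMIAL| DEVICE: `∏_i|x_i|^{a_i}` is within `π∕m` of an `MvPolynomial` of total degree
# `≤ Σ_i(a_i − a_i mod 2) + 2m·#{i : a_i odd}`; the normalised powers `(Σ_i|x_i|∕d)^p` of the ℓ¹-norm are within `π∕m` of total degree `(2m+1)p` —
# a DIMENSION-FREE Jackson rate `≍ p∕n` (the general ℓ¹-Lipschitz class needs `Θ(d²∕n)`, module 109)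

Cell `pub-ymgap`, HUMAN RULING D-0062 (Track A) ∕ D-0149 (work-bound push), R141 (C) wider-strategy seat `pub-ymgap-dag-n19-e` (strategy
s3 = ALTERNATIVE CURRENCY), generation g29, module 3 (lineage module 117).  Route `Summits/QuantumFields/YangMills/Theses/BalabanUVNodes.lean`,
cluster item K3⁸ «SpineGivenEndpointR13SepCoPHV» (stmt-QuantumFields-27366); filed `--supports` that item `--as helper` (it proves no registered
stub).  COUNT-NEUTRAL: [folklore] approximation theory over Mathlib (`MvPolynomial.totalDegree`) and the lineage BY NAME — module 111
`…N19JointLawPriceCompositionsLipschitz` (`exists_jacksonPoly_near`: the one-dimensional Jackson polynomial of `|·|`, degree `≤ 2m`, error `π∕m`),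
module 115 `…N19JointLawPriceAbsolutePolynomials` (`abs_monomial_le_one`, `monomial_mem_Icc`, `l1NormPow_eq_sum`), module 110 (`sum_card_fiber`);
no laws, no scheme object, no Theses import; NOT a discharge claim.

CONTEXT.  The numerical study of CURRENCY-MAP v7 (HOME `numerics/`) is phrased in the DEGREE MODEL `E_k(t) = sup_h dist_∞(h(Σ_{i≤k}|x_i|), Π_t)`;
module 109 typed the general class there (`Θ(d²∕n)` in total degree `n`, tensor Jackson `πKd∕m` at total degree `2md`).  Modules 115∕116 priced the
|monomial| device in the MOMENT currency.  This module types its degree-model face, in module 109's `MvPolynomial` language.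
§1 `eval_plantIn` · `totalDegree_plantIn_le`: a univariate polynomial `q` PLANTED in an arbitrary `MvPolynomial` `g` (`Σ_k [u^k]q·g^k`; evaluation
   `q(g(x))`, total degree `≤ deg q · deg g`) — module 109's `eval_plant` ∕ `totalDegree_plant_le` had `g = X_i`.
§2 ★★ `exists_mvPolynomial_near_prodAbsPow`: for every `a : ι → ℕ` and `m ≥ 1` an `MvPolynomial` of total degree
   `≤ Σ_i(a_i − a_i mod 2) + 2m·Σ_i(a_i mod 2)` within `π∕m` of `∏_i|x_i|^{a_i}` on `[−1,1]^ι`: the even powers are polynomials, and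
   `∏_{a_i odd}|x_i| = |∏_{a_i odd}x_i|` is the Jackson polynomial of `|·|` planted in ONE monomial.  Only the odd exponents pay the factor `2m`, and they pay it
   ONCE EACH — a product of `j` kinked factors at total degree `n` costs `≍ j∕n`, not the tensor scheme's `≍ j²∕n`.
§3 ★★ `exists_mvPolynomial_near_l1NormPow` ((Σ_i|x_i|)^p within `d^p·π∕m` at total degree `≤ (2m+1)p`) · ★★ `exists_mvPolynomial_near_l1NormPow_div`
   (`(Σ_i|x_i|∕d)^p` within `π∕m` at total degree `≤ (2m+1)p`: **`E_n((S∕d)^p) ≤ π∕m` for `n ≥ (2m+1)p`, i.e. `≍ 2πp∕n`, NO `d`** — the conjectured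
   ridge rate `Lip·d∕n` of (v′) for the power links `(s∕d)^p` (Lipschitz constant `p∕d` on `[0,d]`), against `Θ(d²∕n)` for the general class).
§4 ★ `exists_mvPolynomial_near_l1NormLink`: a polynomial link `f(S)`, `deg f ≤ D`: within `(Σ_{p<D}|[s^{p+1}]f|·d^{p+1})·π∕m` at total degree
   `≤ (2m+1)D` (constant term free) — absolutely monotone links at `(f(d) − f(0))·π∕m`.
READING for the open item (v′) (honest): in the degree model the device gives `E_t(S_k^p) ≲ 2πp·k^p∕t`, `E_t((S_k∕k)^p) ≲ 2πp∕t` and, for a link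
`f(s) = Σ_p b_p s^p`, `E_t(f∘S_k) ≲ (2π∕t)·Σ_p p|b_p|k^p` up to the degree bookkeeping `t ≍ (2m+1)·deg` — the numerics' `E_k(t)` conjecture for power and
absolutely monotone links; the oscillating regime (zigzags, `cos ωS` with `kω ≫ log t`) stays OPEN (CURRENCY-MAP v8, OPEN-PROBLEM.md).

HONEST FRAMING (binding).  Elementary and [folklore]; ONE-SIDED (upper bounds); NO consumer in the DAG today (an optimality map of the seat's own
currency, degree model); nothing of Bałaban's instantiated; NE7 NOT PRINTED, NOT proved; N19 NOT discharged; count-neutral.  One finite `T⁴` programme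
at fixed `ε`; nothing continuum ∕ `ℝ⁴` ∕ OS ∕ mass-gap ∕ Clay.  0 `def` ∕ 0 `sorry`.
-/

noncomputable section

open Real Finset Polynomial

namespace Summit.QuantumFields.YangMills.Theorems.BalabanUVNodesN19JacksonAbsolutePowers

open Summit.QuantumFields.YangMills.Theorems.BalabanUVNodesN19JointLawPriceCompositionsLipschitz (exists_jacksonPoly_near)
open Summit.QuantumFields.YangMills.Theorems.BalabanUVNodesN19JointLawPriceAbsolutePolynomials
  (abs_monomial_le_one monomial_mem_Icc l1NormPow_eq_sum)
open Summit.QuantumFields.YangMills.Theorems.BalabanUVNodesN19JointLawPriceCompositions (sum_card_fiber)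

variable {ι : Type*} [Fintype ι]

/-! ## §1 A univariate polynomial planted in an `MvPolynomial` [bookkeeping] -/

omit [Fintype ι] in
/-- `Σ_k [u^k]q · g^k` evaluates to `q(g(x))`. [bookkeeping] -/
theorem eval_plantIn (q : ℝ[X]) (g : MvPolynomial ι ℝ) (x : ι → ℝ) :
    MvPolynomial.eval x (∑ k ∈ range (q.natDegree + 1), MvPolynomial.C (q.coeff k) * g ^ k) = q.eval (MvPolynomial.eval x g) := by
  rw [map_sum, Polynomial.eval_eq_sum_range]
  refine Finset.sum_congr rfl fun k _ => ?_
  rw [map_mul, MvPolynomial.eval_C, map_pow]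

omit [Fintype ι] in
/-- The planted polynomial has total degree `≤ deg q · deg g`. [bookkeeping] -/
theorem totalDegree_plantIn_le (q : ℝ[X]) (g : MvPolynomial ι ℝ) :
    (∑ k ∈ range (q.natDegree + 1), MvPolynomial.C (q.coeff k) * g ^ k).totalDegree ≤ q.natDegree * g.totalDegree := by
  refine MvPolynomial.totalDegree_finsetSum_le fun k hk => ?_
  have hk : k ≤ q.natDegree := Nat.lt_succ_iff.1 (mem_range.1 hk)
  calc (MvPolynomial.C (q.coeff k) * g ^ k).totalDegree
      ≤ (MvPolynomial.C (q.coeff k) : MvPolynomial ι ℝ).totalDegree + (g ^ k).totalDegree := MvPolynomial.totalDegree_mul _ _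
    _ ≤ 0 + k * g.totalDegree := by
        rw [MvPolynomial.totalDegree_C]; exact add_le_add le_rfl (MvPolynomial.totalDegree_pow _ _)
    _ ≤ q.natDegree * g.totalDegree := by rw [zero_add]; exact Nat.mul_le_mul_right _ hk

/-- A monomial `∏_i X_i^{b_i}` has total degree `≤ Σ_i b_i`. [bookkeeping] -/
theorem totalDegree_monomial_le (b : ι → ℕ) : (∏ i, (MvPolynomial.X i : MvPolynomial ι ℝ) ^ b i).totalDegree ≤ ∑ i, b i := by
  refine (MvPolynomial.totalDegree_finsetProd _ _).trans (Finset.sum_le_sum fun i _ => ?_)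
  rw [MvPolynomial.totalDegree_X_pow]

/-- Evaluation of a monomial. [bookkeeping] -/
theorem eval_monomial (b : ι → ℕ) (x : ι → ℝ) :
    MvPolynomial.eval x (∏ i, (MvPolynomial.X i : MvPolynomial ι ℝ) ^ b i) = ∏ i, x i ^ b i := by
  rw [map_prod]
  exact Finset.prod_congr rfl fun i _ => by rw [map_pow, MvPolynomial.eval_X]

/-! ## §2 ★★ Absolute monomials: only the odd exponents pay, and they pay once each [folklore] -/

/-- ★★ **`∏_i|x_i|^{a_i}` WITHIN `π∕m` AT TOTAL DEGREE `Σ_i(a_i − a_i mod 2) + 2m·#{i : a_i odd}`.**  For every exponent vector `a : ι → ℕ` and `m ≥ 1`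
there is `P : MvPolynomial ι ℝ` with `P.totalDegree ≤ Σ_i(a_i − a_i mod 2) + 2m·Σ_i(a_i mod 2)` and `|∏_i|x_i|^{a_i} − P(x)| ≤ π∕m` on `[−1,1]^ι`:
`P = (∏_i X_i^{a_i − a_i mod 2})·q(∏_i X_i^{a_i mod 2})` with `q` the Jackson polynomial of `|·|` of degree `≤ 2m` (module 111), since
`∏_i|x_i|^{a_i} = (∏_i x_i^{a_i − a_i mod 2})·|∏_i x_i^{a_i mod 2}|` and both factors are bounded by one on the cube. [folklore] -/
theorem exists_mvPolynomial_near_prodAbsPow (a : ι → ℕ) {m : ℕ} (hm : 0 < m) :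
    ∃ P : MvPolynomial ι ℝ, P.totalDegree ≤ (∑ i, (a i - a i % 2)) + 2 * m * ∑ i, a i % 2 ∧
      ∀ x : ι → ℝ, (∀ i, x i ∈ Set.Icc (-1 : ℝ) 1) → |(∏ i, |x i| ^ a i) - MvPolynomial.eval x P| ≤ π / m := by
  -- the Jackson polynomial of `|·|`
  have hK : ∀ u v : ℝ, u ∈ Set.Icc (-1 : ℝ) 1 → v ∈ Set.Icc (-1 : ℝ) 1 → |abs u - abs v| ≤ 1 * |u - v| :=
    fun u v _ _ => by rw [one_mul]; exact abs_abs_sub_abs_le_abs_sub u v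
  have hG : ∀ u : ℝ, u ∈ Set.Icc (-1 : ℝ) 1 → |abs u| ≤ 1 := fun u hu => by
    rw [abs_abs]; exact abs_le.2 ⟨hu.1, hu.2⟩
  obtain ⟨q, hqdeg, hqerr, -, -⟩ := exists_jacksonPoly_near zero_le_one hK hG hm
  set E : MvPolynomial ι ℝ := ∏ i, (MvPolynomial.X i : MvPolynomial ι ℝ) ^ (a i - a i % 2) with hE
  set M : MvPolynomial ι ℝ := ∏ i, (MvPolynomial.X i : MvPolynomial ι ℝ) ^ (a i % 2) with hM
  set Q : MvPolynomial ι ℝ := ∑ k ∈ range (q.natDegree + 1), MvPolynomial.C (q.coeff k) * M ^ k with hQ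
  refine ⟨E * Q, ?_, ?_⟩
  · calc (E * Q).totalDegree ≤ E.totalDegree + Q.totalDegree := MvPolynomial.totalDegree_mul _ _
      _ ≤ (∑ i, (a i - a i % 2)) + q.natDegree * M.totalDegree :=
          add_le_add (totalDegree_monomial_le _) (totalDegree_plantIn_le q M)
      _ ≤ (∑ i, (a i - a i % 2)) + 2 * m * ∑ i, a i % 2 :=
          add_le_add le_rfl (Nat.mul_le_mul hqdeg (totalDegree_monomial_le _))
  · intro x hx
    have hsplit : ∏ i, |x i| ^ a i = (∏ i, x i ^ (a i - a i % 2)) * |∏ i, x i ^ (a i % 2)| := by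
      rw [Finset.abs_prod, ← Finset.prod_mul_distrib]
      refine Finset.prod_congr rfl fun i _ => ?_
      have heven : Even (a i - a i % 2) := ⟨a i / 2, by omega⟩
      rw [← heven.pow_abs, abs_pow, ← pow_add, Nat.sub_add_cancel (Nat.mod_le (a i) 2)]
    have heval : MvPolynomial.eval x (E * Q) = (∏ i, x i ^ (a i - a i % 2)) * q.eval (∏ i, x i ^ (a i % 2)) := by
      rw [map_mul, hE, eval_monomial, hQ, eval_plantIn, hM, eval_monomial]
    rw [hsplit, heval, ← mul_sub, abs_mul]
    calc |∏ i, x i ^ (a i - a i % 2)| * |(|∏ i, x i ^ (a i % 2)|) - q.eval (∏ i, x i ^ (a i % 2))|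
        ≤ 1 * (1 * (π / m)) := mul_le_mul (abs_monomial_le_one hx _) (hqerr _ (monomial_mem_Icc hx _)) (abs_nonneg _) zero_le_one
      _ = π / m := by ring

/-! ## §3 ★★ Powers of the ℓ¹-norm: a dimension-free Jackson rate [folklore] -/

/-- ★★ **`(Σ_i|x_i|)^p` WITHIN `d^p·π∕m` AT TOTAL DEGREE `(2m+1)p`.**  For every `p` and `m ≥ 1` there is `P : MvPolynomial ι ℝ` of total degree
`≤ (2m+1)p` with `|(Σ_i|x_i|)^p − P(x)| ≤ d^p·π∕m` on `[−1,1]^ι` (`d = |ι|`): the `d^p` absolute monomials of module 115's expansion, each at §2.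
[folklore] -/
theorem exists_mvPolynomial_near_l1NormPow (p : ℕ) {m : ℕ} (hm : 0 < m) :
    ∃ P : MvPolynomial ι ℝ, P.totalDegree ≤ (2 * m + 1) * p ∧
      ∀ x : ι → ℝ, (∀ i, x i ∈ Set.Icc (-1 : ℝ) 1) →
        |(∑ i, |x i|) ^ p - MvPolynomial.eval x P| ≤ (Fintype.card ι : ℝ) ^ p * (π / m) := by
  classical
  choose Pf hPdeg hPerr using fun f : Fin p → ι =>
    exists_mvPolynomial_near_prodAbsPow (ι := ι) (fun i => (Finset.univ.filter fun k => f k = i).card) hm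
  refine ⟨∑ f : Fin p → ι, Pf f, ?_, ?_⟩
  · refine MvPolynomial.totalDegree_finsetSum_le fun f _ => (hPdeg f).trans ?_
    have hsum : ∑ i, (Finset.univ.filter fun k => f k = i).card = p := sum_card_fiber f
    have h1 : ∑ i, ((Finset.univ.filter fun k => f k = i).card - (Finset.univ.filter fun k => f k = i).card % 2) ≤ p := by
      conv_rhs => rw [← hsum]
      exact Finset.sum_le_sum fun i _ => Nat.sub_le _ _
    have h2 : ∑ i, (Finset.univ.filter fun k => f k = i).card % 2 ≤ p := by
      conv_rhs => rw [← hsum]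
      exact Finset.sum_le_sum fun i _ => Nat.mod_le _ _
    calc (∑ i, ((Finset.univ.filter fun k => f k = i).card - (Finset.univ.filter fun k => f k = i).card % 2)) +
          2 * m * ∑ i, (Finset.univ.filter fun k => f k = i).card % 2
        ≤ p + 2 * m * p := add_le_add h1 (Nat.mul_le_mul_left _ h2)
      _ = (2 * m + 1) * p := by ring
  · intro x hx
    rw [l1NormPow_eq_sum x p, map_sum, ← Finset.sum_sub_distrib]
    calc |∑ f : Fin p → ι, ((∏ i, |x i| ^ (Finset.univ.filter fun k => f k = i).card) - MvPolynomial.eval x (Pf f))|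
        ≤ ∑ f : Fin p → ι, |(∏ i, |x i| ^ (Finset.univ.filter fun k => f k = i).card) - MvPolynomial.eval x (Pf f)| :=
          abs_sum_le_sum_abs _ _
      _ ≤ ∑ _f : Fin p → ι, π / m := Finset.sum_le_sum fun f _ => hPerr f x hx
      _ = (Fintype.card ι : ℝ) ^ p * (π / m) := by
          rw [Finset.sum_const, Finset.card_univ, Fintype.card_fun, Fintype.card_fin, nsmul_eq_mul, Nat.cast_pow]

/-- ★★ **THE NORMALISED POWERS `(Σ_i|x_i|∕d)^p`: WITHIN `π∕m` AT TOTAL DEGREE `(2m+1)p` — NO `d`.**  For `ι` nonempty, every `p` and `m ≥ 1` there is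
`P : MvPolynomial ι ℝ` of total degree `≤ (2m+1)p` with `|(Σ_i|x_i|∕d)^p − P(x)| ≤ π∕m` on `[−1,1]^ι`.  In the numerics' language:
`E_n((S_k∕k)^p) ≤ π∕m` whenever `n ≥ (2m+1)p`, uniformly in `k` — the dimension-free Jackson rate `≍ p∕n` for the power links of the ℓ¹-norm (the
general ℓ¹-Lipschitz class needs `Θ(k²∕n)`, module 109; the tensor Jackson approximant of `(S∕k)^p` would cost `≍ pk∕n`). [folklore] -/
theorem exists_mvPolynomial_near_l1NormPow_div [Nonempty ι] (p : ℕ) {m : ℕ} (hm : 0 < m) :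
    ∃ P : MvPolynomial ι ℝ, P.totalDegree ≤ (2 * m + 1) * p ∧
      ∀ x : ι → ℝ, (∀ i, x i ∈ Set.Icc (-1 : ℝ) 1) →
        |((∑ i, |x i|) / Fintype.card ι) ^ p - MvPolynomial.eval x P| ≤ π / m := by
  obtain ⟨P, hdeg, herr⟩ := exists_mvPolynomial_near_l1NormPow (ι := ι) p hm
  have hd : (0 : ℝ) < (Fintype.card ι : ℝ) ^ p := pow_pos (Nat.cast_pos.2 Fintype.card_pos) p
  refine ⟨MvPolynomial.C (((Fintype.card ι : ℝ) ^ p)⁻¹) * P, ?_, ?_⟩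
  · calc (MvPolynomial.C (((Fintype.card ι : ℝ) ^ p)⁻¹) * P).totalDegree
        ≤ (MvPolynomial.C (((Fintype.card ι : ℝ) ^ p)⁻¹) : MvPolynomial ι ℝ).totalDegree + P.totalDegree :=
          MvPolynomial.totalDegree_mul _ _
      _ ≤ (2 * m + 1) * p := by rw [MvPolynomial.totalDegree_C, zero_add]; exact hdeg
  · intro x hx
    rw [map_mul, MvPolynomial.eval_C, div_pow,
      show (∑ i, |x i|) ^ p / (Fintype.card ι : ℝ) ^ p - ((Fintype.card ι : ℝ) ^ p)⁻¹ * MvPolynomial.eval x P =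
          ((Fintype.card ι : ℝ) ^ p)⁻¹ * ((∑ i, |x i|) ^ p - MvPolynomial.eval x P) by ring,
      abs_mul, abs_inv, abs_of_pos hd, inv_mul_le_iff₀ hd]
    exact herr x hx

/-! ## §4 ★ Polynomial links of the ℓ¹-norm by absolute coefficient mass [folklore] -/

/-- ★ **POLYNOMIAL LINKS: `f(Σ_i|x_i|)` WITHIN `(Σ_{p<D}|[s^{p+1}]f|·d^{p+1})·π∕m` AT TOTAL DEGREE `(2m+1)D`.**  For a real polynomial `f` of degree `≤ D`
and `m ≥ 1` there is `P : MvPolynomial ι ℝ` of total degree `≤ (2m+1)D` with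
`|f(Σ_i|x_i|) − P(x)| ≤ (Σ_{p<D}|[s^{p+1}]f|·d^{p+1})·π∕m` on `[−1,1]^ι` (the constant term is exact).  For an ABSOLUTELY MONOTONE link the mass is
`f(d) − f(0) ≤ d·sup_{[0,d]}f′` — the conjectured ridge rate of (v′) in the degree model, for this sub-class. [folklore] -/
theorem exists_mvPolynomial_near_l1NormLink (f : ℝ[X]) {D : ℕ} (hf : f.natDegree ≤ D) {m : ℕ} (hm : 0 < m) :
    ∃ P : MvPolynomial ι ℝ, P.totalDegree ≤ (2 * m + 1) * D ∧
      ∀ x : ι → ℝ, (∀ i, x i ∈ Set.Icc (-1 : ℝ) 1) →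
        |f.eval (∑ i, |x i|) - MvPolynomial.eval x P| ≤
          (∑ p ∈ range D, |f.coeff (p + 1)| * (Fintype.card ι : ℝ) ^ (p + 1)) * (π / m) := by
  classical
  choose Pp hPdeg hPerr using fun p : ℕ => exists_mvPolynomial_near_l1NormPow (ι := ι) p hm
  refine ⟨MvPolynomial.C (f.coeff 0) + ∑ p ∈ range D, MvPolynomial.C (f.coeff (p + 1)) * Pp (p + 1), ?_, ?_⟩
  · refine (MvPolynomial.totalDegree_add _ _).trans (max_le ?_ ?_)
    · rw [MvPolynomial.totalDegree_C]; exact Nat.zero_le _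
    · refine MvPolynomial.totalDegree_finsetSum_le fun p hp => ?_
      have hp' : p + 1 ≤ D := mem_range.1 hp
      calc (MvPolynomial.C (f.coeff (p + 1)) * Pp (p + 1)).totalDegree
          ≤ (MvPolynomial.C (f.coeff (p + 1)) : MvPolynomial ι ℝ).totalDegree + (Pp (p + 1)).totalDegree :=
            MvPolynomial.totalDegree_mul _ _
        _ ≤ 0 + (2 * m + 1) * (p + 1) := by rw [MvPolynomial.totalDegree_C]; exact add_le_add le_rfl (hPdeg (p + 1))
        _ ≤ (2 * m + 1) * D := by rw [zero_add]; exact Nat.mul_le_mul_left _ hp'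
  · intro x hx
    have hfS : f.eval (∑ i, |x i|) = (∑ p ∈ range D, f.coeff (p + 1) * (∑ i, |x i|) ^ (p + 1)) + f.coeff 0 := by
      rw [Polynomial.eval_eq_sum_range' (Nat.lt_succ_of_le hf), Finset.sum_range_succ', pow_zero, mul_one]
    have hevP : MvPolynomial.eval x (MvPolynomial.C (f.coeff 0) + ∑ p ∈ range D, MvPolynomial.C (f.coeff (p + 1)) * Pp (p + 1)) =
        f.coeff 0 + ∑ p ∈ range D, f.coeff (p + 1) * MvPolynomial.eval x (Pp (p + 1)) := by
      rw [map_add, MvPolynomial.eval_C, map_sum]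
      refine congrArg _ (Finset.sum_congr rfl fun p _ => ?_)
      rw [map_mul, MvPolynomial.eval_C]
    have hdiff : f.eval (∑ i, |x i|) -
          MvPolynomial.eval x (MvPolynomial.C (f.coeff 0) + ∑ p ∈ range D, MvPolynomial.C (f.coeff (p + 1)) * Pp (p + 1)) =
        ∑ p ∈ range D, f.coeff (p + 1) * ((∑ i, |x i|) ^ (p + 1) - MvPolynomial.eval x (Pp (p + 1))) := by
      rw [hfS, hevP, add_comm (f.coeff 0) _, add_sub_add_right_eq_sub, ← Finset.sum_sub_distrib]
      exact Finset.sum_congr rfl fun p _ => (mul_sub _ _ _).symm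
    rw [hdiff, Finset.sum_mul]
    refine (abs_sum_le_sum_abs _ _).trans (Finset.sum_le_sum fun p _ => ?_)
    rw [abs_mul, mul_assoc]
    exact mul_le_mul_of_nonneg_left (hPerr (p + 1) x hx) (abs_nonneg _)

end Summit.QuantumFields.YangMills.Theorems.BalabanUVNodesN19JacksonAbsolutePowers

end
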